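/-
VALUE = THEOREM (sphere geometry for the all-`p` reflection-class certificate), NOT summit
progress (cell b2b-lgcu-borel, gen 24); the crux item stmt-MatrixMultiplication-14079 is untouched.
-/
import Mathlib
import Summits.MatrixMultiplication.MatrixMultiplication.Theorems.SubgroupIdentityDesigns.Negative.ReflectionClassCertificate

/-!
# The sphere `Q(v) = c`, `χ(−c) = −1`, in `𝔽_p³`: anisotropy and the latitude form of the weight

VALUE = THEOREM (generic in the prime `p`), NOT summit progress; the crux item
stmt-MatrixMultiplication-14079 is untouched and remains open.

Layer F1 of the all-`p` proof of the unified reflection-class certificate (ORACLE-g24 §G24-1 L0,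
§G24-2).  With `Q(v) = v ⬝ᵥ v` on `𝔽_p³` and a level `c` with `−c` a NON-SQUARE:

* `perp_anisotropic` — `X₀^⊥` is anisotropic when `Q(X₀) = c` (cross-product proof:
  `X₀ × (X₀ × d) = −c·d` would make `−c` a square);
* `neg_dot_isSquare_of_perp_isotropic` — for isotropic `x ≠ 0` every `z ⊥ x` has `−Q(z)` a
  square; hence (`dot_ne_zero_of_isotropic`) no point of the sphere `Q = c` is orthogonal to an
  isotropic vector;
* `eq_base_iff` / `eq_neg_base_iff` — on the sphere, `v = ±X₀ ↔ v·X₀ = ±c`;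
* `wt_eq_lat` — the certificate weight `ReflectionClassCertificate.wt c X₀` is, on the sphere, the
  LATITUDE function `lat c (v·X₀)`; `lat_neg` (oddness) and `wt_base_ne_zero` (`w(X₀) ≠ 0` for
  `p ≥ 5`).

HONEST SCOPE.  Geometry only; by itself it excludes nothing.
-/

set_option linter.dupNamespace false

open scoped BigOperators Matrix

namespace Summit.MatrixMultiplication.MatrixMultiplication.Theorems.SubgroupIdentityDesigns.Negative
namespace ReflectionClassSphere

open ReflectionClassCertificate (V chi wt)

variable {p : ℕ} [hp : Fact p.Prime]

/-! ## Cross products and anisotropy -/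

/-- If `u ≠ 0` and `u × v = 0` then `v` is a multiple of `u`. -/
theorem exists_smul_of_cross_eq_zero {u v : V p} (hu : u ≠ 0) (h : u ⨯₃ v = 0) :
    ∃ a : ZMod p, a • u = v := by
  by_contra hne
  exact (crossProduct_ne_zero_iff_linearIndependent.mpr
    ((LinearIndependent.pair_iff' hu).mpr fun a ha => hne ⟨a, ha⟩)) h

/-- **`X₀^⊥` is anisotropic** when `−Q(X₀)` is a non-square: `d ⊥ X₀`, `Q(d) = 0 ⇒ d = 0`. -/
theorem perp_anisotropic {c : ZMod p} (hc : ¬ IsSquare (-c)) {X₀ d : V p} (hX : X₀ ⬝ᵥ X₀ = c)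
    (hdX : d ⬝ᵥ X₀ = 0) (hdd : d ⬝ᵥ d = 0) : d = 0 := by
  by_contra hd
  have h1 : d ⨯₃ (X₀ ⨯₃ d) = 0 := by
    rw [cross_cross_eq_smul_sub_smul', hdd, zero_smul, zero_sub, dotProduct_comm X₀ d, hdX,
      zero_smul, neg_zero]
  obtain ⟨a, ha⟩ := exists_smul_of_cross_eq_zero hd h1
  have h2 : X₀ ⨯₃ (X₀ ⨯₃ d) = (-c) • d := by
    rw [cross_cross_eq_smul_sub_smul', dotProduct_comm X₀ d, hdX, zero_smul, zero_sub, hX,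
      neg_smul]
  have h3 : X₀ ⨯₃ (X₀ ⨯₃ d) = (a * a) • d := by
    rw [← ha, map_smul, ← ha, smul_smul]
  have h4 : (a * a + c) • d = 0 := by
    rw [add_smul, ← h3, h2, neg_smul, neg_add_cancel]
  have h5 : a * a + c = 0 := (smul_eq_zero.mp h4).resolve_right hd
  exact hc ⟨a, by linear_combination -h5⟩

/-- For isotropic `x ≠ 0`, every `z ⊥ x` has `−Q(z)` a square. -/
theorem neg_dot_isSquare_of_perp_isotropic {x z : V p} (hx : x ≠ 0) (hxx : x ⬝ᵥ x = 0)
    (hzx : z ⬝ᵥ x = 0) : IsSquare (-(z ⬝ᵥ z)) := by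
  have h1 : x ⨯₃ (x ⨯₃ z) = 0 := by
    rw [cross_cross_eq_smul_sub_smul', hxx, zero_smul, sub_zero, dotProduct_comm x z, hzx,
      zero_smul]
  obtain ⟨a, ha⟩ := exists_smul_of_cross_eq_zero hx h1
  have h2 : z ⨯₃ (x ⨯₃ z) = (z ⬝ᵥ z) • x := by
    rw [cross_cross_eq_smul_sub_smul', dotProduct_comm x z, hzx, zero_smul, sub_zero]
  have h3 : z ⨯₃ (x ⨯₃ z) = (-(a * a)) • x := by
    rw [← ha, map_smul, ← cross_anticomm x z, ← ha, smul_neg, smul_smul, neg_smul]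
  have h4 : (z ⬝ᵥ z + a * a) • x = 0 := by
    rw [add_smul, ← h2, h3, neg_smul, neg_add_cancel]
  have h5 : z ⬝ᵥ z + a * a = 0 := (smul_eq_zero.mp h4).resolve_right hx
  exact ⟨a, by linear_combination -h5⟩

/-- No point of the sphere `Q = c` (`−c` a non-square) is orthogonal to an isotropic `x ≠ 0`. -/
theorem dot_ne_zero_of_isotropic {c : ZMod p} (hc : ¬ IsSquare (-c)) {x v : V p} (hx : x ≠ 0)
    (hxx : x ⬝ᵥ x = 0) (hv : v ⬝ᵥ v = c) : v ⬝ᵥ x ≠ 0 := fun h =>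
  hc (hv ▸ neg_dot_isSquare_of_perp_isotropic hx hxx h)

/-- `−c` a non-square forces `c ≠ 0`. -/
theorem ne_zero_of_nonsquare {c : ZMod p} (hc : ¬ IsSquare (-c)) : c ≠ 0 := by
  rintro rfl
  exact hc (by rw [neg_zero]; exact IsSquare.zero)

/-- A base point of the sphere is non-zero. -/
theorem base_ne_zero {c : ZMod p} (hc : ¬ IsSquare (-c)) {X₀ : V p} (hX : X₀ ⬝ᵥ X₀ = c) :
    X₀ ≠ 0 := by
  rintro rfl
  exact ne_zero_of_nonsquare hc (by rw [← hX, dotProduct_zero])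

/-! ## Poles and latitude -/

section Sphere

variable {c : ZMod p} {X₀ v : V p}

/-- On the sphere: `Q(v − X₀) = 2c − 2 v·X₀`. -/
theorem dot_sub_self (hX : X₀ ⬝ᵥ X₀ = c) (hv : v ⬝ᵥ v = c) :
    (v - X₀) ⬝ᵥ (v - X₀) = 2 * c - 2 * (v ⬝ᵥ X₀) := by
  simp only [sub_dotProduct, dotProduct_sub, hv, hX, dotProduct_comm X₀ v]
  ring

/-- On the sphere: `Q(v + X₀) = 2c + 2 v·X₀`. -/
theorem dot_add_self (hX : X₀ ⬝ᵥ X₀ = c) (hv : v ⬝ᵥ v = c) :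
    (v + X₀) ⬝ᵥ (v + X₀) = 2 * c + 2 * (v ⬝ᵥ X₀) := by
  simp only [add_dotProduct, dotProduct_add, hv, hX, dotProduct_comm X₀ v]
  ring

/-- On the sphere, `v = X₀ ↔ v·X₀ = c` (the pole is the only point of extreme latitude). -/
theorem eq_base_iff (hc : ¬ IsSquare (-c)) (hX : X₀ ⬝ᵥ X₀ = c) (hv : v ⬝ᵥ v = c) :
    v = X₀ ↔ v ⬝ᵥ X₀ = c := by
  constructor
  · rintro rfl; exact hX
  · intro h
    have hd : (v - X₀) ⬝ᵥ (v - X₀) = 0 := by rw [dot_sub_self hX hv, h]; ring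
    have hdX : (v - X₀) ⬝ᵥ X₀ = 0 := by rw [sub_dotProduct, h, hX, sub_self]
    exact sub_eq_zero.mp (perp_anisotropic hc hX hdX hd)

/-- On the sphere, `v = −X₀ ↔ v·X₀ = −c`. -/
theorem eq_neg_base_iff (hc : ¬ IsSquare (-c)) (hX : X₀ ⬝ᵥ X₀ = c) (hv : v ⬝ᵥ v = c) :
    v = -X₀ ↔ v ⬝ᵥ X₀ = -c := by
  constructor
  · rintro rfl; rw [neg_dotProduct, hX]
  · intro h
    have hd : (v + X₀) ⬝ᵥ (v + X₀) = 0 := by rw [dot_add_self hX hv, h]; ring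
    have hdX : (v + X₀) ⬝ᵥ X₀ = 0 := by rw [add_dotProduct, h, hX, neg_add_cancel]
    exact eq_neg_of_add_eq_zero_left (perp_anisotropic hc hX hdX hd)

end Sphere

/-- The LATITUDE profile of the unified weight:
`Λ_c(t) = χ(−1)(χ(2c + 2t) − χ(2c − 2t)) + (1 − χ(−1)) χ(2t) + p([t = c] − [t = −c])`. -/
def lat (c t : ZMod p) : ℤ :=
  chi (-1 : ZMod p) * (chi (2 * c + 2 * t) - chi (2 * c - 2 * t)) +
    (1 - chi (-1 : ZMod p)) * chi (2 * t) +
    ((if t = c then (p : ℤ) else 0) - (if t = -c then (p : ℤ) else 0))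

/-- **Latitude form of the weight:** on the sphere, `wt c X₀ v = Λ_c(v·X₀)`. -/
theorem wt_eq_lat {c : ZMod p} (hc : ¬ IsSquare (-c)) {X₀ v : V p} (hX : X₀ ⬝ᵥ X₀ = c)
    (hv : v ⬝ᵥ v = c) : wt c X₀ v = lat c (v ⬝ᵥ X₀) := by
  unfold wt lat
  rw [if_pos hv, dot_add_self hX hv, dot_sub_self hX hv]
  simp only [eq_base_iff hc hX hv, eq_neg_base_iff hc hX hv]

/-! ## Values of `chi` -/

/-- `chi` is the quadratic character. -/
theorem chi_eq (a : ZMod p) : chi a = quadraticChar (ZMod p) a := by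
  rw [quadraticChar_apply, quadraticCharFun, ReflectionClassCertificate.chi]

/-- `chi a ∈ {0, 1, −1}`. -/
theorem chi_cases (a : ZMod p) : chi a = 0 ∨ chi a = 1 ∨ chi a = -1 := by
  unfold ReflectionClassCertificate.chi
  split_ifs <;> simp

/-- `chi (−1) = ±1`. -/
theorem chi_neg_one_cases : chi (-1 : ZMod p) = 1 ∨ chi (-1 : ZMod p) = -1 := by
  have h : (-1 : ZMod p) ≠ 0 := neg_ne_zero.mpr one_ne_zero
  unfold ReflectionClassCertificate.chi
  rw [if_neg h]
  split_ifs <;> simp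

/-- `chi (−1)² = 1`. -/
theorem chi_neg_one_mul_self : chi (-1 : ZMod p) * chi (-1 : ZMod p) = 1 := by
  rcases chi_neg_one_cases (p := p) with h | h <;> rw [h] <;> norm_num

/-- `chi` is multiplicative. -/
theorem chi_mul (a b : ZMod p) : chi (a * b) = chi a * chi b := by
  rw [chi_eq, chi_eq, chi_eq, map_mul]

/-- **Oddness of the latitude profile**: `Λ_c(−t) = −Λ_c(t)`. -/
theorem lat_neg (c t : ZMod p) : lat c (-t) = -lat c t := by
  unfold lat
  have e1 : 2 * c + 2 * -t = 2 * c - 2 * t := by ring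
  have e2 : 2 * c - 2 * -t = 2 * c + 2 * t := by ring
  have e3 : (2 * -t) = (-1) * (2 * t) := by ring
  have i1 : (-t = c) ↔ (t = -c) := neg_eq_iff_eq_neg
  have i2 : (-t = -c) ↔ (t = c) := neg_inj
  rw [e1, e2, e3, chi_mul]
  simp only [i1, i2]
  have h := chi_neg_one_mul_self (p := p)
  split_ifs <;> linear_combination (-chi (2 * t)) * h

/-- **Oddness of the weight** in `v` (`−c` a non-square). -/
theorem wt_neg {c : ZMod p} (hc : ¬ IsSquare (-c)) {X₀ : V p} (hX : X₀ ⬝ᵥ X₀ = c)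
    (v : V p) : wt c X₀ (-v) = -wt c X₀ v := by
  by_cases hv : v ⬝ᵥ v = c
  · have hv' : (-v) ⬝ᵥ (-v) = c := by rw [neg_dotProduct, dotProduct_neg, neg_neg, hv]
    rw [wt_eq_lat hc hX hv', wt_eq_lat hc hX hv, neg_dotProduct, lat_neg]
  · have hv' : ¬ (-v) ⬝ᵥ (-v) = c := by rwa [neg_dotProduct, dotProduct_neg, neg_neg]
    rw [ReflectionClassCertificate.wt_off hv, ReflectionClassCertificate.wt_off hv', neg_zero]

/-- **The base point carries non-zero weight** for `p ≥ 5`: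
`w(X₀) = p + χ(−1)χ(4c) + (1 − χ(−1))χ(2c) ≥ p − 3 > 0`. -/
theorem wt_base_ne_zero (hp5 : 5 ≤ p) {c : ZMod p} (hc : ¬ IsSquare (-c)) {X₀ : V p}
    (hX : X₀ ⬝ᵥ X₀ = c) : wt c X₀ X₀ ≠ 0 := by
  have hp2 : p ≠ 2 := by omega
  have hX0 : X₀ ≠ 0 := base_ne_zero hc hX
  have hne : X₀ ≠ -X₀ := by
    intro h
    have h2 : (2 : ZMod p) • X₀ = 0 := by rw [two_smul]; nth_rw 2 [h]; rw [add_neg_cancel]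
    have h2' : (2 : ZMod p) ≠ 0 := Ring.two_ne_zero (by rw [ZMod.ringChar_zmod_n]; exact hp2)
    exact hX0 ((smul_eq_zero.mp h2).resolve_left h2')
  unfold wt
  rw [if_pos hX, if_pos rfl, if_neg hne, sub_self, dotProduct_zero]
  have h0 : chi (0 : ZMod p) = 0 := by unfold ReflectionClassCertificate.chi; rw [if_pos rfl]
  rw [h0]
  rcases chi_neg_one_cases (p := p) with h1 | h1 <;>
    rcases chi_cases ((X₀ + X₀) ⬝ᵥ (X₀ + X₀)) with h2 | h2 | h2 <;>
      rcases chi_cases (2 * (X₀ ⬝ᵥ X₀)) with h3 | h3 | h3 <;>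
        rw [h1, h2, h3] <;> push_cast <;> omega

end ReflectionClassSphere
end Summit.MatrixMultiplication.MatrixMultiplication.Theorems.SubgroupIdentityDesigns.Negative
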